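import Summits.BirchSwinnertonDyer.BirchSwinnertonDyer.Theorems.UniversalToricDescentStrictPlaceSurjectiveAnyTorsion
import Summits.BirchSwinnertonDyer.BirchSwinnertonDyer.Theorems.UniversalToricDescentResidualSelmerKummerComap
import HarnessLib

/-!
# Route UniversalToricDescent — the TUPLE signature at the strict place: kernel `Sel_𝔭^Σ`, onto for `E[p^∞]`,
# and onto MODULO THE LOCAL KUMMER KERNEL for `E[p]` (step (γb1) of the (L)-free residual comparison)

Lead prover bsd-wall-utd-p1 g13 (`--supports` ♭T′ stmt-BirchSwinnertonDyer-26975; stub B′ `stub_lambdaTransportPT`, memo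
RESIDUE-B-PRIME-utdp1g13 §3). Notation: `H = ker κ`, `G = kerD κ 𝔭 ≤ D_𝔭`, `A = E[p^∞]`, `M = E[p]`,
`ι : H¹(H, M) → H¹(H, A)` (`torsionToPrimaryH1Sub`), `ι_G : H¹(G, M) → H¹(G, A)`, `G_rel^Σ = selmerAc W p κ v₀ Σ`
(fake strict place `v₀ ∤ p`, `v₀ ∉ Σ`: away conditions off `Σ`, nothing above `p`), exact index `κ(D_𝔭) = p^c ℤ_p`.
The tuple signature `Ψ s = (res_G(conj_{γ^i} s))_{i < p^c}` evaluates the equivariant signature on the coset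
representatives `γ^i` of `D_𝔭 \ Γ_K / H`:

* §1 `mem_selmerAc_iff_forall_resKerD_eq_zero_of_mem_relaxed`, `mem_selmerAc_iff_forall_fin_of_mem_relaxed` — for
  `s ∈ G_rel^Σ`: `s ∈ Sel_𝔭^Σ ⟺ res_G(conj_σ s) = 0 ∀ σ ⟺ Ψ s = 0` (the kernel of `Ψ` on `G_rel^Σ` is `Sel_𝔭^Σ`);
* §2 `exists_mem_relaxed_forall_fin_resKerD_eq` — **`Ψ : G_rel^Σ → H¹(G, A)^{p^c}` is ONTO** (from
  `exists_mem_selmerAc_relaxed_forall_resKerD_strictPlace_eq_anyTorsion`: a tuple extends to an equivariant function);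
* §3 `resKerD_iota_comm`, `exists_comap_forall_fin_iota_resKerD_eq` — naturality `ι_G ∘ res_G = res_G ∘ ι`, and
  **the residual tuple signature is onto modulo `ker ι_G`**: for every `f : Fin p^c → H¹(G, M)` there is
  `u ∈ ι⁻¹(G_rel^Σ) ⊂ H¹(H, M)` with `ι_G(res_G(conj_{γ^i} u)) = ι_G(f i)` for all `i` — from §2, the `p`-DIVISIBILITY
  `Sel_𝔭^Σ = p·Sel_𝔭^Σ` (hypothesis; on the route `selmerAc_divisible_of_finite_pTorsion_anyTorsion`) and the Kummer lift.

With the local Kummer kernel count (`…LocalKummerKernel`: `#ker ι_G = #E[p]^G` when `E(K_{∞,𝔭})[p^∞]` is finite) this is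
the input of the (L)-free count `#Sel_𝔭^Σ(A)[p] · [H¹(G,M)^{p^c} : I] = #R_strict · #ker(ι_G)^{p^c}` (sequel).
HONEST STATUS: helper theorems, CONDITIONAL on the cited Poitou–Tate facts through §2; THEOREMS ONLY; no definition,
no named fact, no `sorry`. BSD is not advanced by this file.
References: [GreenbergVatsal2000] §2 Prop. (2.1), Cor. (2.3), Prop. (2.8) (pp. 23–27); [GreenbergLNM1716] §5 p. 114.
-/

set_option autoImplicit false
-- `…BirchSwinnertonDyer.BirchSwinnertonDyer.Theorems…` is the problem's mandated namespace (D-0017).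
set_option linter.dupNamespace false

noncomputable section

open scoped Classical

namespace Summit.BirchSwinnertonDyer.BirchSwinnertonDyer.Theorems.UniversalToricDescentStrictPlaceTuple

open CategoryTheory Function Field NumberField IsDedekindDomain WeierstrassCurve
open Literature.NumberTheory.GaloisRepresentations Literature.NumberTheory.EllipticCurves
  Literature.NumberTheory.EllipticCurves.GreenbergSelmer Literature.NumberTheory.GaloisCohomology
  Summit.BirchSwinnertonDyer.Rank1Residual Summit.BirchSwinnertonDyer.Rank1Residual.X11b
  Summit.BirchSwinnertonDyer.Rank1Residual.X11b.Coinv Summit.BirchSwinnertonDyer.Rank1Residual.X11b.LocBridge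
  Summit.BirchSwinnertonDyer.Rank1Residual.X11b.AcSelmer
  Summit.BirchSwinnertonDyer.BirchSwinnertonDyer.Theorems.UniversalToricDescentSigmaCoinvariants
  Summit.BirchSwinnertonDyer.BirchSwinnertonDyer.Theorems.UniversalToricDescentSigmaLocalStabilizer
  Summit.BirchSwinnertonDyer.BirchSwinnertonDyer.Theorems.UniversalToricDescentSigmaLocalImage

variable {K : Type} [Field K] [NumberField K] (W : WeierstrassCurve K) [W.IsElliptic] (p : ℕ)
  [Fact p.Prime] (κ : ZpExtension K p)

/-! ### §1 The kernel of the signature on `G_rel^Σ` is `Sel_𝔭^Σ` -/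

omit [W.IsElliptic] in
/-- **For `s ∈ G_rel^Σ = selmerAc W p κ v₀ Σ` (`v₀ ∤ p`, `v₀ ∉ Σ`): `s ∈ Sel_𝔭^Σ` iff `res_G(conj_σ s) = 0` for all `σ`**
(the two groups share the away and infinite clauses; `Sel_𝔭^Σ` adds the strict clause at `𝔭`, `G_rel^Σ` the away
clause at `v₀`, which is one of the away clauses). [cite: Castella2018, Def. 2.2 (arXiv:1704.06608 p. 5)] -/
theorem mem_selmerAc_iff_forall_resKerD_eq_zero_of_mem_relaxed {𝔭 : HeightOneSpectrum (𝓞 K)}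
    {S : Set (HeightOneSpectrum (𝓞 K))} {v₀ : HeightOneSpectrum (𝓞 K)}
    {s : W.subgroupH1 p κ.kerSubgroup} (hs : s ∈ selmerAc W p κ v₀ S) :
    s ∈ selmerAc W p κ 𝔭 S ↔
      ∀ σ : absoluteGaloisGroup K, resKerD κ (W.geomPrimaryTorsion p) 𝔭 (W.conjH1 p κ.kerSubgroup σ s) = 0 := by
  have hs' := (mem_selmerOver_iff_awayKer _ _ s).mp hs
  constructor
  · intro h σ
    exact (mem_awayKer_iff_resKerD_eq_zero κ 𝔭 _).1 (((mem_selmerOver_iff_awayKer _ _ s).mp h).2.2 σ)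
  · intro h0
    change s ∈ selmerOver κ.kerSubgroup (W.geomPrimaryTorsion p) p 𝔭 S
    rw [mem_selmerOver_iff_awayKer]
    exact ⟨hs'.1, hs'.2.1, fun σ ↦ (mem_awayKer_iff_resKerD_eq_zero κ 𝔭 _).2 (h0 σ)⟩

omit [W.IsElliptic] in
/-- The away clause at the fake strict place is redundant: `selmerAc W p κ 𝔭 S ≤ selmerAc W p κ v₀ S` for `v₀ ∤ p`,
`v₀ ∉ S`. [cite: Castella2018, Def. 2.2 (arXiv:1704.06608 p. 5)] -/
theorem selmerAc_le_relaxed (𝔭 : HeightOneSpectrum (𝓞 K)) {S : Set (HeightOneSpectrum (𝓞 K))}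
    {v₀ : HeightOneSpectrum (𝓞 K)} (hv₀ : ((p : ℕ) : 𝓞 K) ∉ v₀.asIdeal) (hv₀S : v₀ ∉ S) :
    selmerAc W p κ 𝔭 S ≤ selmerAc W p κ v₀ S := by
  intro s hs
  have hs' := (mem_selmerOver_iff_awayKer _ _ s).mp hs
  change s ∈ selmerOver κ.kerSubgroup (W.geomPrimaryTorsion p) p v₀ S
  rw [mem_selmerOver_iff_awayKer]
  exact ⟨hs'.1, hs'.2.1, fun σ ↦ hs'.1 v₀ hv₀ hv₀S σ⟩

omit [W.IsElliptic] in
/-- **Tuple form of the kernel**: for `s ∈ G_rel^Σ` and the exact index `κ(D_𝔭) = p^c ℤ_p`, `s ∈ Sel_𝔭^Σ` iff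
`res_G(conj_{γ^i} s) = 0` for all `i < p^c` (`Γ_K = D_𝔭 γ^{<p^c} H` and the signature is `H`-invariant,
`D_𝔭`-equivariant). [cite: GreenbergVatsal2000, §2 Cor. (2.3) (p. 25)] -/
theorem mem_selmerAc_iff_forall_fin_of_mem_relaxed {γ : absoluteGaloisGroup K} (hγ : κ.IsTopGenerator γ)
    {𝔭 : HeightOneSpectrum (𝓞 K)} {c : ℕ}
    (hc : ∀ z : ℤ_[p], ∃ d : decomp (K := K) 𝔭, (κ (d : absoluteGaloisGroup K)).toAdd = (p : ℤ_[p]) ^ c * z)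
    {S : Set (HeightOneSpectrum (𝓞 K))} {v₀ : HeightOneSpectrum (𝓞 K)}
    {s : W.subgroupH1 p κ.kerSubgroup} (hs : s ∈ selmerAc W p κ v₀ S) :
    s ∈ selmerAc W p κ 𝔭 S ↔
      ∀ i : Fin (p ^ c), resKerD κ (W.geomPrimaryTorsion p) 𝔭 (W.conjH1 p κ.kerSubgroup (γ ^ (i : ℕ)) s) = 0 := by
  rw [mem_selmerAc_iff_forall_resKerD_eq_zero_of_mem_relaxed W p κ hs]
  constructor
  · exact fun h i ↦ h _
  · intro h σ
    obtain ⟨d, n, h', hn, hh, rfl⟩ := exists_decomp_mul_pow_lt_mul_mem_ker κ hγ 𝔭 hc σ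
    rw [W.conjH1_mul_holds p κ.kerSubgroup, AddMonoidHom.comp_apply, W.conjH1_of_mem_holds p κ.kerSubgroup hh,
      AddMonoidHom.id_apply, W.conjH1_mul_holds p κ.kerSubgroup, AddMonoidHom.comp_apply, resKerD_conjH1,
      h ⟨n, hn⟩, map_zero]

/-! ### §2 The tuple signature `G_rel^Σ → H¹(G, E[p^∞])^{p^c}` is onto -/

/-- **Every tuple `(f_i)_{i<p^c}` of classes of `H¹(H ∩ D_𝔭, E[p^∞])` is `(res_G(conj_{γ^i} s))_i` for some
`s ∈ G_rel^Σ`**, under the hypotheses of `exists_mem_selmerAc_relaxed_forall_resKerD_strictPlace_eq_anyTorsion` and the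
exact index of `D_𝔭`: a tuple extends to the right-`H`-invariant, left-`D_𝔭`-equivariant function `d γ^i h ↦ conj_d f_i`
(well defined: the cosets `D_𝔭 γ^i H`, `i < p^c`, are distinct and `H ∩ D_𝔭` acts trivially), which is a signature.
[cite: GreenbergVatsal2000, §2 Prop. (2.1) and Cor. (2.3) (pp. 23–25)] -/
theorem exists_mem_relaxed_forall_fin_resKerD_eq [IsTotallyComplex K]
    (hPT : poitouTate_selmerStructure_duality K)
    (hEP : ∀ v : HeightOneSpectrum (𝓞 K), localEulerPoincareCharacteristic (v.adicCompletion K))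
    {𝔭 𝔮 : HeightOneSpectrum (𝓞 K)} (h𝔭 : ((p : ℕ) : 𝓞 K) ∈ 𝔭.asIdeal)
    (h𝔮 : ((p : ℕ) : 𝓞 K) ∈ 𝔮.asIdeal) (hne : 𝔮 ≠ 𝔭)
    {m : ℕ} (htor𝔮 : ∀ Q : W.geomPrimaryTorsion p, (∀ d ∈ decomp 𝔮, d • Q = Q) → p ^ m • Q = 0)
    (hfin : Finite (selmerAcBase W p 𝔮 ∅))
    (h2 : Subsingleton (galoisCohomology (primaryGaloisModule W p) 2))
    {γ : absoluteGaloisGroup K} (hγ : κ.IsTopGenerator γ) (S : Set (HeightOneSpectrum (𝓞 K)))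
    {v₀ : HeightOneSpectrum (𝓞 K)} (hv₀ : ((p : ℕ) : 𝓞 K) ∉ v₀.asIdeal) (hv₀S : v₀ ∉ S) {c : ℕ}
    (hc : ∀ z : ℤ_[p], ∃ d : decomp (K := K) 𝔭, (κ (d : absoluteGaloisGroup K)).toAdd = (p : ℤ_[p]) ^ c * z)
    (hle : ∀ d : decomp (K := K) 𝔭, (p : ℤ_[p]) ^ c ∣ (κ (d : absoluteGaloisGroup K)).toAdd)
    (f : Fin (p ^ c) → subgroupH1 (kerD κ 𝔭) (W.geomPrimaryTorsion p)) :
    ∃ s ∈ selmerAc W p κ v₀ S, ∀ i : Fin (p ^ c),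
      resKerD κ (W.geomPrimaryTorsion p) 𝔭 (W.conjH1 p κ.kerSubgroup (γ ^ (i : ℕ)) s) = f i := by
  set H := κ.kerSubgroup with hH
  -- `𝔭` is finitely decomposed: `κ d₁ = p^c ≠ 0`
  have hv : ¬ (decomp 𝔭 ≤ H) := by
    obtain ⟨d₁, hd₁⟩ := hc 1
    intro hle'
    have h1 : κ (d₁ : absoluteGaloisGroup K) = 1 := (ZpExtension.mem_kerSubgroup).mp (hle' d₁.2)
    rw [h1, toAdd_one, mul_one] at hd₁
    exact (pow_ne_zero c (Nat.cast_ne_zero.mpr (Fact.out : p.Prime).ne_zero)) hd₁.symm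
  -- the decomposition `σ = d(σ) γ^{n(σ)} h(σ)`
  choose dσ nσ hσ hnσ hhσ heσ using exists_decomp_mul_pow_lt_mul_mem_ker κ hγ 𝔭 hc
  -- `conj_d` only depends on `d` modulo `H ∩ D_𝔭`
  have hconj : ∀ (d d' : decomp (K := K) 𝔭) (x : subgroupH1 (kerD κ 𝔭) (W.geomPrimaryTorsion p)),
      ((d⁻¹ * d' : decomp (K := K) 𝔭) : absoluteGaloisGroup K) ∈ H →
      conjH1 (kerD κ 𝔭) (W.geomPrimaryTorsion p) d' x =
        conjH1 (kerD κ 𝔭) (W.geomPrimaryTorsion p) d x := by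
    intro d d' x hmem
    conv_lhs => rw [← mul_inv_cancel_left d d', conjH1_mul_holds (kerD κ 𝔭),
      AddMonoidHom.comp_apply, conjH1_of_mem_holds (kerD κ 𝔭) _ ((mem_kerD_iff κ 𝔭 _).2 hmem),
      AddMonoidHom.id_apply]
  -- uniqueness of the decomposition
  have huniq : ∀ (d d' : decomp (K := K) 𝔭) (i j : ℕ) (h h' : absoluteGaloisGroup K),
      i < p ^ c → j < p ^ c → h ∈ H → h' ∈ H →
      (d : absoluteGaloisGroup K) * γ ^ i * h = (d' : absoluteGaloisGroup K) * γ ^ j * h' →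
      i = j ∧ ((d'⁻¹ * d : decomp (K := K) 𝔭) : absoluteGaloisGroup K) ∈ H := by
    intro d d' i j h h' hi hj hh hh' e
    have hij := eq_of_decomp_mul_pow_mul_eq κ hγ 𝔭 hle hi hj hh hh' e
    subst hij
    refine ⟨rfl, ?_⟩
    have e' : ((d'⁻¹ * d : decomp (K := K) 𝔭) : absoluteGaloisGroup K) = γ ^ i * (h' * h⁻¹) * (γ ^ i)⁻¹ := by
      have e2 : (d : absoluteGaloisGroup K) = (d' : absoluteGaloisGroup K) * γ ^ i * h' * h⁻¹ * (γ ^ i)⁻¹ := by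
        rw [← e]; group
      rw [Subgroup.coe_mul, Subgroup.coe_inv, e2]
      group
    rw [e']
    exact Subgroup.Normal.conj_mem inferInstance _ (H.mul_mem hh' (H.inv_mem hh)) _
  let F : absoluteGaloisGroup K → subgroupH1 (kerD κ 𝔭) (W.geomPrimaryTorsion p) :=
    fun σ ↦ conjH1 (kerD κ 𝔭) (W.geomPrimaryTorsion p) (dσ σ) (f ⟨nσ σ, hnσ σ⟩)
  have hFapply : ∀ σ, F σ = conjH1 (kerD κ 𝔭) (W.geomPrimaryTorsion p) (dσ σ) (f ⟨nσ σ, hnσ σ⟩) :=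
    fun _ ↦ rfl
  -- `F(d γ^i h) = conj_d (f i)`
  have hFval : ∀ (d : decomp (K := K) 𝔭) (i : ℕ) (hi : i < p ^ c) (h : absoluteGaloisGroup K),
      h ∈ H → F ((d : absoluteGaloisGroup K) * γ ^ i * h) =
        conjH1 (kerD κ 𝔭) (W.geomPrimaryTorsion p) d (f ⟨i, hi⟩) := by
    intro d i hi h hh
    set σ := (d : absoluteGaloisGroup K) * γ ^ i * h with hσdef
    obtain ⟨hij, hmem⟩ := huniq d (dσ σ) i (nσ σ) h (hσ σ) hi (hnσ σ) hh (hhσ σ) (heσ σ)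
    rw [hFapply, hconj d (dσ σ) _ ?_]
    · congr 2
      exact Fin.ext hij.symm
    · have := H.inv_mem hmem
      rwa [← Subgroup.coe_inv, mul_inv_rev, inv_inv] at this
  have hFH : ∀ (σ h : absoluteGaloisGroup K), h ∈ H → F (σ * h) = F σ := by
    intro σ h hh
    conv_lhs => rw [heσ σ, mul_assoc, hFval (dσ σ) (nσ σ) (hnσ σ) _ (H.mul_mem (hhσ σ) hh)]
  have hFD : ∀ (d : decomp (K := K) 𝔭) (σ : absoluteGaloisGroup K),
      F ((d : absoluteGaloisGroup K) * σ) = conjH1 (kerD κ 𝔭) (W.geomPrimaryTorsion p) d (F σ) := by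
    intro d σ
    conv_lhs => rw [heσ σ, ← mul_assoc, ← mul_assoc, ← Subgroup.coe_mul,
      hFval (d * dσ σ) (nσ σ) (hnσ σ) _ (hhσ σ)]
    rw [conjH1_mul_holds (kerD κ 𝔭), AddMonoidHom.comp_apply, hFapply]
  obtain ⟨s, hs, hsF⟩ := exists_mem_selmerAc_relaxed_forall_resKerD_strictPlace_eq_anyTorsion W p κ hPT hEP h𝔭
    h𝔮 hne htor𝔮 hfin h2 hγ S hv₀ hv₀S hv F hFH hFD
  refine ⟨s, hs, fun i ↦ ?_⟩
  obtain ⟨i, hi⟩ := i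
  change resKerD κ (W.geomPrimaryTorsion p) 𝔭 (W.conjH1 p H (γ ^ i) s) = f ⟨i, hi⟩
  rw [hsF, show γ ^ i = ((1 : decomp (K := K) 𝔭) : absoluteGaloisGroup K) * γ ^ i * 1 by
    rw [Subgroup.coe_one, one_mul, mul_one], hFval 1 i hi 1 H.one_mem,
    Literature.NumberTheory.EllipticCurves.conjH1_one_holds (kerD κ 𝔭), AddMonoidHom.id_apply]

/-! ### §3 The residual tuple signature is onto modulo the local Kummer kernel -/

omit [W.IsElliptic] in
/-- **Naturality: `ι_G ∘ res_G = res_G ∘ ι`** (both composites are the map of the compatible pair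
`(H ∩ D_𝔭 ↪ H, E[p] ↪ E[p^∞])`). [cite: SerreGaloisCohomology1997, I §2.4] -/
theorem resKerD_iota_comm (𝔭 : HeightOneSpectrum (𝓞 K))
    (y : Literature.NumberTheory.EllipticCurves.subgroupH1 κ.kerSubgroup (W.geomTorsion (p : ℤ))) :
    resH1Hom (ContinuousMonoidHom.id (kerD κ 𝔭))
        (AddSubgroup.inclusion (geomTorsion_le_geomPrimaryTorsion W p)) (fun _ _ ↦ rfl)
        (resKerD κ (W.geomTorsion (p : ℤ)) 𝔭 y) =
      resKerD κ (W.geomPrimaryTorsion p) 𝔭 (W.torsionToPrimaryH1Sub p κ.kerSubgroup y) := by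
  change ((resH1Hom (ContinuousMonoidHom.id (kerD κ 𝔭))
      (AddSubgroup.inclusion (geomTorsion_le_geomPrimaryTorsion W p)) (fun _ _ ↦ rfl)).comp
      (resKerD κ (W.geomTorsion (p : ℤ)) 𝔭)) y =
    ((resKerD κ (W.geomPrimaryTorsion p) 𝔭).comp (W.torsionToPrimaryH1Sub p κ.kerSubgroup)) y
  rw [resKerD, resKerD, WeierstrassCurve.torsionToPrimaryH1Sub, resH1Hom_comp, resH1Hom_comp]
  exact congrFun (congrArg DFunLike.coe (resH1Hom_congr (by ext; rfl) (by ext; rfl) _ _)) y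

omit [W.IsElliptic] in
/-- `H¹(H ∩ D_𝔭, E[p])` is killed by `p` (its coefficients are). [cite: SerreGaloisCohomology1997, I §2.2] -/
theorem p_smul_subgroupH1_kerD_geomTorsion_eq_zero (𝔭 : HeightOneSpectrum (𝓞 K))
    (y : Literature.NumberTheory.EllipticCurves.subgroupH1 (kerD κ 𝔭) (W.geomTorsion (p : ℤ))) : p • y = 0 := by
  obtain ⟨φ, rfl⟩ := oneCocycleClass_surjective _ y
  have h := oneCocycleClass_smul (discreteTopRep (kerD κ 𝔭) (geomTorsion W (p : ℤ))) (p : ℤ) φ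
  have hφ : (p : ℤ) • φ = 0 := by
    apply Subtype.ext
    ext g
    change (((p : ℤ) • φ.1 g : geomTorsion W (p : ℤ)) : geomPoints W) = 0
    rw [AddSubgroupClass.coe_zsmul]
    exact (φ.1 g).2
  rw [← Nat.cast_smul_eq_nsmul ℤ, ← h, hφ, oneCocycleClass_zero]

/-- **The residual tuple signature is onto modulo `ker ι_G`.** Under the hypotheses of §2 and the `p`-divisibility
`Sel_𝔭^Σ = p·Sel_𝔭^Σ` of Castella's Selmer group over `K_∞` (on the route: `selmerAc_divisible_of_finite_pTorsion_anyTorsion`):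
for every tuple `f : Fin p^c → H¹(H ∩ D_𝔭, E[p])` there is `u ∈ ι⁻¹(G_rel^Σ) ⊂ H¹(H, E[p])` with
`ι_G(res_G(conj_{γ^i} u)) = ι_G(f i)` for all `i`. Proof: §2 gives `s ∈ G_rel^Σ` with signature `ι_G ∘ f`; `p s` has
signature `0`, so `p s ∈ Sel_𝔭^Σ = p·Sel_𝔭^Σ`, `p s = p s₁`; `s − s₁` is `p`-torsion, hence `ι u` (Kummer lift), and
`u` has residual signature `≡ f` modulo `ker ι_G`. [cite: GreenbergVatsal2000, §2 Prop. (2.8) (pp. 26–27)]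
[cite: GreenbergLNM1716, §5 p. 114] -/
theorem exists_comap_forall_fin_iota_resKerD_eq [IsTotallyComplex K]
    (hPT : poitouTate_selmerStructure_duality K)
    (hEP : ∀ v : HeightOneSpectrum (𝓞 K), localEulerPoincareCharacteristic (v.adicCompletion K))
    {𝔭 𝔮 : HeightOneSpectrum (𝓞 K)} (h𝔭 : ((p : ℕ) : 𝓞 K) ∈ 𝔭.asIdeal)
    (h𝔮 : ((p : ℕ) : 𝓞 K) ∈ 𝔮.asIdeal) (hne : 𝔮 ≠ 𝔭)
    {m : ℕ} (htor𝔮 : ∀ Q : W.geomPrimaryTorsion p, (∀ d ∈ decomp 𝔮, d • Q = Q) → p ^ m • Q = 0)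
    (hfin : Finite (selmerAcBase W p 𝔮 ∅))
    (h2 : Subsingleton (galoisCohomology (primaryGaloisModule W p) 2))
    {γ : absoluteGaloisGroup K} (hγ : κ.IsTopGenerator γ) (S : Set (HeightOneSpectrum (𝓞 K)))
    {v₀ : HeightOneSpectrum (𝓞 K)} (hv₀ : ((p : ℕ) : 𝓞 K) ∉ v₀.asIdeal) (hv₀S : v₀ ∉ S) {c : ℕ}
    (hc : ∀ z : ℤ_[p], ∃ d : decomp (K := K) 𝔭, (κ (d : absoluteGaloisGroup K)).toAdd = (p : ℤ_[p]) ^ c * z)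
    (hle : ∀ d : decomp (K := K) 𝔭, (p : ℤ_[p]) ^ c ∣ (κ (d : absoluteGaloisGroup K)).toAdd)
    (hdiv : ∀ s ∈ selmerAc W p κ 𝔭 S, ∃ s' ∈ selmerAc W p κ 𝔭 S, p • s' = s)
    (f : Fin (p ^ c) → Literature.NumberTheory.EllipticCurves.subgroupH1 (kerD κ 𝔭) (W.geomTorsion (p : ℤ))) :
    ∃ u ∈ (selmerAc W p κ v₀ S).comap (W.torsionToPrimaryH1Sub p κ.kerSubgroup), ∀ i : Fin (p ^ c),
      resH1Hom (ContinuousMonoidHom.id (kerD κ 𝔭))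
          (AddSubgroup.inclusion (geomTorsion_le_geomPrimaryTorsion W p)) (fun _ _ ↦ rfl)
          (resKerD κ (W.geomTorsion (p : ℤ)) 𝔭
            (Literature.NumberTheory.EllipticCurves.conjH1 κ.kerSubgroup (W.geomTorsion (p : ℤ)) (γ ^ (i : ℕ)) u)) =
        resH1Hom (ContinuousMonoidHom.id (kerD κ 𝔭))
          (AddSubgroup.inclusion (geomTorsion_le_geomPrimaryTorsion W p)) (fun _ _ ↦ rfl) (f i) := by
  set H := κ.kerSubgroup with hH
  set ιG : Literature.NumberTheory.EllipticCurves.subgroupH1 (kerD κ 𝔭) (W.geomTorsion (p : ℤ)) →+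
      subgroupH1 (kerD κ 𝔭) (W.geomPrimaryTorsion p) := resH1Hom (ContinuousMonoidHom.id (kerD κ 𝔭))
    (AddSubgroup.inclusion (geomTorsion_le_geomPrimaryTorsion W p)) (fun _ _ ↦ rfl) with hιG
  -- §2 for the tuple `ι_G ∘ f`
  obtain ⟨s, hs, hsf⟩ := exists_mem_relaxed_forall_fin_resKerD_eq W p κ hPT hEP h𝔭 h𝔮 hne htor𝔮 hfin h2 hγ S
    hv₀ hv₀S hc hle (fun i ↦ ιG (f i))
  -- `p s ∈ Sel_𝔭^Σ`
  have hps : p • s ∈ selmerAc W p κ 𝔭 S := by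
    rw [mem_selmerAc_iff_forall_fin_of_mem_relaxed W p κ hγ hc (AddSubgroup.nsmul_mem _ hs p)]
    intro i
    rw [map_nsmul, map_nsmul, hsf, ← map_nsmul, p_smul_subgroupH1_kerD_geomTorsion_eq_zero, map_zero]
  -- divisibility: `p s = p s₁` with `s₁ ∈ Sel`
  obtain ⟨s₁, hs₁, hps₁⟩ := hdiv _ hps
  -- Kummer lift of the `p`-torsion class `s − s₁`
  have htors : p • (s - s₁) = 0 := by rw [smul_sub, hps₁, sub_self]
  obtain ⟨u, hu⟩ := W.exists_torsionToPrimaryH1Sub_eq p W.zsmul_geomPoints_surjective_holds htors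
  have hs₁' : s₁ ∈ selmerAc W p κ v₀ S := selmerAc_le_relaxed W p κ 𝔭 hv₀ hv₀S hs₁
  refine ⟨u, ?_, fun i ↦ ?_⟩
  · rw [AddSubgroup.mem_comap, hu]
    exact sub_mem hs hs₁'
  · have h0 : resKerD κ (W.geomPrimaryTorsion p) 𝔭 (W.conjH1 p H (γ ^ (i : ℕ)) s₁) = 0 :=
      ((mem_selmerAc_iff_forall_fin_of_mem_relaxed W p κ hγ hc hs₁').mp hs₁) i
    rw [hιG, resKerD_iota_comm, ← WeierstrassCurve.conjH1_torsionToPrimaryH1Sub, hu, map_sub, map_sub, hsf, h0,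
      sub_zero]

end Summit.BirchSwinnertonDyer.BirchSwinnertonDyer.Theorems.UniversalToricDescentStrictPlaceTuple

end
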